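import Literature.NumberTheory.LFunctions.SuzukiWeilKernelProofs
import Literature.NumberTheory.LFunctions.SuzukiWeilOrthogonalSetProofs
import HarnessLib

/-!
# CJM Thm. 5.5 (1) from the orthogonal basis: `Suzuki2025_orthogonalBasis → Suzuki2025_thm55_normIdentity`

LINE 1 — LABEL: RH-CONSEQUENCE proofs (every theorem about the zeros carries the explicit binder
`RiemannHypothesis →`, never dropped) about the RH-EQUIVALENT·PRINTED residual `IsolatedV0` of the
cell rh-crit/dbl (M. Suzuki, *On the Hilbert space derived from the Weil distribution*, Canad. J.
Math. 2025 = arXiv:2301.00421v3, Thm. 5.5 (1) and Prop. 5.8). bears_on: B-C/B-P (LADDER-RH COLUMN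
6 DBR). WHAT THIS IS NOT: a reduction of one printed RH-CONSEQUENCE (the norm identity
`‖ψ‖² = ½⟨ψ,ψ⟩_W` on `V(0)`, the ONE fact the converse `RH ⟹ IsolatedV0` rests on) to another
(completeness of Suzuki's orthogonal family `ψ_γ`, clause 6 of `Suzuki2025_orthogonalBasis` =
CJM Prop. 4.1 / de Branges' Thm. 22); it does not move RH; nothing here bears on the truth of RH.

## What is proved

Following the printed proof of CJM Thm. 5.5 (1) (TeX l.1713–1757: "For `ψ = Σ c_γψ_γ ∈ V(0)`, we
have `‖ψ‖² = (2π)⁻¹Σ|c_γ|²` by the orthogonality and `ψ̂(γ) = c_γ/√(m_γπ)` by applying (4.2) to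
`ψ̂ = Σ c_γF_γ`. From these two and (1.2), we get (5.10)"), with the one analytic point the print
leaves implicit — that the evaluation `ψ ↦ ψ̂(γ)` at a REAL zero `γ` is a continuous linear
functional on `V(0)` — made explicit as a reproducing kernel:

* §A (RH-FREE local analysis): at every real point `x₀` the symbol `Θ_ξ = E_ξ♯/E_ξ` agrees, on a
  punctured neighbourhood, with a function `q` analytic at `x₀` satisfying the reflection identity
  `q(ū)·conj q(u) = 1` (`exists_analyticAt_lagariasTheta_germ`; real zeros of `E_ξ`, i.e. multiple
  critical zeros of `ξ`, are removable for `Θ_ξ` and are handled, never assumed away);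
* §B (under RH): the model-space kernels `K_{γ+iy}` (`modelKernelVec`, the cell's
  `SuzukiWeilKernelProofs`) converge in `L²(ℝ)` to `K_γ := (i/2π)(1 + Θ_ξ)/(· − γ)` as `y ↓ 0`
  (`tendsto_modelKernelVec`; dominated convergence with the bound `|1 − conj Θ(w)Θ(x)| ≤ C|x − w̄|`
  from §A near `γ` and `|Θ| ≤ 1` away), hence for `ψ ∈ V(0)` the boundary value
  `ψ̂(γ) = lim_{y↓0} ψ̂(γ+iy) = ⟪K_γ, 𝖥ψ⟫` EXISTS and any `HasHatValue`-value equals it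
  (`hasHatValue_inner_modelKernelVecReal`, `HasHatValue.eq_inner_modelKernelVecReal`) — this is
  also clause (a) of `Suzuki2025_lemma53` ("`S_ψ` is defined");
* §C (under RH): **`Suzuki2025_thm55_normIdentity_of_orthogonalBasis`** — given the orthogonal
  basis `{ψ_γ}` with its values (4.2), `Σ_γ m_γ ψ̂(γ) conj ψ̂(γ̄) = 2‖ψ‖²` for every `ψ ∈ V(0)`:
  Parseval in the closed subspace `V(0)` (Mathlib `HilbertBasis.mk` on `suzukiVSubmodule 0`) and
  the continuity of `ψ ↦ ⟪K_γ, 𝖥ψ⟫`, exactly as printed.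

## References
* M. Suzuki, Canad. J. Math. 2025 = arXiv:2301.00421v3, Thm. 5.5 (1) p. 15 (TeX l.1676–1757),
  Prop. 4.1 / (4.2) p. 10, Lemma 5.3 p. 14, §2.4 p. 5. [Suzuki2025WeilHilbertSpace]
* L. de Branges, *Hilbert spaces of entire functions* (1968), Thm. 22 (the completeness input,
  carried here as the hypothesis `Suzuki2025_orthogonalBasis`). [cited via Suzuki2025WeilHilbertSpace]
-/

noncomputable section

open MeasureTheory Complex Filter Set FourierTransform
open scoped ComplexConjugate FourierTransform Topology Real ENNReal InnerProductSpace

namespace Literature.NumberTheory.LFunctions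

open ZetaZeros Literature.Analysis.DeBrangesSpaces

/-! ## A. The symbol `Θ_ξ` near a real point (RH-FREE) -/

/-- `E_ξ` has finite order of vanishing everywhere (it is entire and `E_ξ(0) ≠ 0`). RH-FREE.
[cite: Suzuki2025WeilHilbertSpace, CJM eq. (1.2) p. 2 ("the entire function E_ξ")] -/
theorem analyticOrderAt_lagariasE_ne_top (z : ℂ) : analyticOrderAt lagariasE z ≠ ⊤ := by
  intro htop
  have hev := analyticOrderAt_eq_top.1 htop
  have hA : AnalyticOnNhd ℂ lagariasE univ := fun u _ ↦ differentiable_lagariasE.analyticAt u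
  have := hA.eqOn_zero_of_preconnected_of_eventuallyEq_zero isPreconnected_univ (mem_univ z) hev
    (mem_univ (0 : ℂ))
  exact lagariasE_zero_ne_zero this

/-- **The analytic germ of `Θ_ξ` at a real point.** For every real `x₀` there is `q`, analytic at
`x₀`, with `Θ_ξ = q` on a punctured neighbourhood of `x₀` and the reflection identity
`q(ū)·conj q(u) = 1` near `x₀` (write `E_ξ = (z − x₀)ᵏe₁` with `e₁(x₀) ≠ 0`; then
`E_ξ♯ = (z − x₀)ᵏe₁♯` because `x₀` is real, and `q = e₁♯/e₁`). In particular `|q(x₀)| = 1`: the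
real zeros of `E_ξ` (the multiple zeros of `ξ` on the critical line) are removable singularities of
`Θ_ξ = E_ξ♯/E_ξ`, which is how "`|Θ(z)| = 1` for every `z ∈ ℝ`" and "`Θ` is meromorphic in `ℂ`"
are read. RH-FREE. [cite: Suzuki2025WeilHilbertSpace, CJM §3.2 p. 8 (TeX l.985–990: "|Θ(z)| = 1 for every z ∈ ℝ … meromorphic") and §2.4 p. 5 (TeX l.707–711: "meromorphic inner function")] -/
theorem exists_analyticAt_lagariasTheta_germ (x₀ : ℝ) :
    ∃ q : ℂ → ℂ, AnalyticAt ℂ q x₀ ∧ (∀ᶠ u in 𝓝[≠] (x₀ : ℂ), lagariasTheta u = q u) ∧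
      ∀ᶠ u in 𝓝 (x₀ : ℂ), q (conj u) * conj (q u) = 1 := by
  have hEa : AnalyticAt ℂ lagariasE (x₀ : ℂ) := differentiable_lagariasE.analyticAt _
  obtain ⟨e₁, he₁, he₁0, hEeq⟩ := (hEa.analyticOrderAt_ne_top).1 (analyticOrderAt_lagariasE_ne_top _)
  set k : ℕ := analyticOrderNatAt lagariasE (x₀ : ℂ) with hk
  -- conjugation fixes `x₀` and maps neighbourhoods of `x₀` to neighbourhoods of `x₀`
  have hconj : Tendsto (conj : ℂ → ℂ) (𝓝 (x₀ : ℂ)) (𝓝 (x₀ : ℂ)) := by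
    have := Complex.continuous_conj.tendsto (x₀ : ℂ)
    rwa [Complex.conj_ofReal] at this
  have he₁ne : ∀ᶠ u in 𝓝 (x₀ : ℂ), e₁ u ≠ 0 := he₁.continuousAt.eventually_ne he₁0
  have he₁ne' : ∀ᶠ u in 𝓝 (x₀ : ℂ), e₁ (conj u) ≠ 0 := hconj.eventually he₁ne
  have hEeq' : ∀ᶠ u in 𝓝 (x₀ : ℂ), lagariasE (conj u) = (conj u - x₀) ^ k • e₁ (conj u) :=
    hconj.eventually hEeq
  set q : ℂ → ℂ := fun u ↦ conj (e₁ (conj u)) / e₁ u with hq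
  have he₁c : AnalyticAt ℂ (fun u ↦ conj (e₁ (conj u))) (x₀ : ℂ) := by
    refine analyticAt_conj_conj ?_
    rwa [Complex.conj_ofReal]
  refine ⟨q, he₁c.div he₁ he₁0, ?_, ?_⟩
  · have hne : ∀ᶠ u in 𝓝[≠] (x₀ : ℂ), u ≠ (x₀ : ℂ) := self_mem_nhdsWithin
    filter_upwards [hne, (hEeq.and (hEeq'.and he₁ne)).filter_mono nhdsWithin_le_nhds]
      with u hu h
    obtain ⟨hEu, hEu', he⟩ := h
    have hux : (u - x₀) ^ k ≠ 0 := pow_ne_zero _ (sub_ne_zero.2 hu)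
    rw [lagariasTheta, sharp_apply, hEu', hEu]
    simp only [smul_eq_mul, map_mul, map_pow, map_sub, Complex.conj_conj, Complex.conj_ofReal, hq]
    field_simp
  · filter_upwards [he₁ne, he₁ne'] with u h1 h2
    have h1' : conj (e₁ u) ≠ 0 := (map_ne_zero _).2 h1
    simp only [hq, Complex.conj_conj, map_div₀]
    field_simp

/-- **Local control of `Θ_ξ` at a real point** (the form used for the kernel estimate): a ball
`B(x₀, r)` and a function `q`, complex differentiable on the ball with `‖q‖, ‖q′‖ ≤ M` there, such
that `Θ_ξ = q` on the punctured ball and `q(ū)·conj q(u) = 1` on the ball. RH-FREE.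
[cite: Suzuki2025WeilHilbertSpace, CJM §3.2 p. 8 (TeX l.985–990) and §2.4 p. 5 (TeX l.707–711)] -/
theorem exists_ball_lagariasTheta_control (x₀ : ℝ) :
    ∃ q : ℂ → ℂ, ∃ r > (0 : ℝ), ∃ M : ℝ, 0 ≤ M ∧
      (∀ u ∈ Metric.ball (x₀ : ℂ) r, DifferentiableAt ℂ q u) ∧
      (∀ u ∈ Metric.ball (x₀ : ℂ) r, ‖q u‖ ≤ M) ∧
      (∀ u ∈ Metric.ball (x₀ : ℂ) r, ‖deriv q u‖ ≤ M) ∧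
      (∀ u ∈ Metric.ball (x₀ : ℂ) r, u ≠ (x₀ : ℂ) → lagariasTheta u = q u) ∧
      (∀ u ∈ Metric.ball (x₀ : ℂ) r, q (conj u) * conj (q u) = 1) := by
  obtain ⟨q, hq, hΘ, hrefl⟩ := exists_analyticAt_lagariasTheta_germ x₀
  set M : ℝ := max (‖q x₀‖ + 1) (‖deriv q x₀‖ + 1) with hM
  have hM0 : 0 ≤ M := le_max_of_le_left (by positivity)
  have h1 : ∀ᶠ u in 𝓝 (x₀ : ℂ), DifferentiableAt ℂ q u :=
    hq.eventually_analyticAt.mono fun u hu ↦ hu.differentiableAt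
  have h2 : ∀ᶠ u in 𝓝 (x₀ : ℂ), ‖q u‖ ≤ M :=
    (continuous_norm.continuousAt.tendsto.comp hq.continuousAt).eventually_le_const
      (lt_of_lt_of_le (by linarith) (le_max_left _ _)) |>.mono fun u hu ↦ hu
  have h3 : ∀ᶠ u in 𝓝 (x₀ : ℂ), ‖deriv q u‖ ≤ M :=
    (continuous_norm.continuousAt.tendsto.comp hq.deriv.continuousAt).eventually_le_const
      (lt_of_lt_of_le (by linarith) (le_max_right _ _)) |>.mono fun u hu ↦ hu
  have h4 : ∀ᶠ u in 𝓝 (x₀ : ℂ), u ≠ (x₀ : ℂ) → lagariasTheta u = q u :=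
    eventually_nhdsWithin_iff.1 hΘ
  obtain ⟨r, hr, hball⟩ := Metric.eventually_nhds_iff_ball.1 (h1.and (h2.and (h3.and (h4.and hrefl))))
  exact ⟨q, r, hr, M, hM0, fun u hu ↦ (hball u hu).1, fun u hu ↦ (hball u hu).2.1,
    fun u hu ↦ (hball u hu).2.2.1, fun u hu ↦ (hball u hu).2.2.2.1, fun u hu ↦ (hball u hu).2.2.2.2⟩

/-- Under RH, `|Θ_ξ(w)| ≤ 1` on the open upper half-plane (`|E♯| < |E|` there, [La06] Thm. 1).
RH-CONSEQUENCE. [cite: Suzuki2025WeilHilbertSpace, CJM §3.2 p. 8 (TeX l.985–988: "if the RH is true … |Θ(z)| < 1")] -/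
theorem norm_lagariasTheta_le_one_of_im_pos (hRH : RiemannHypothesis) {w : ℂ} (hw : 0 < w.im) :
    ‖lagariasTheta w‖ ≤ 1 := by
  have hE := Lagarias2006_thm1_onlyif_holds hRH
  rw [lagariasTheta, norm_div]
  exact div_le_one_of_le₀ (hE.norm_sharp_lt hw).le (norm_nonneg _)

/-- Under RH, `Θ_ξ(w) → −1` as `w → γ` (`γ ∈ Γ`; from the cell's RH-free limit (4.1)
`(1+Θ(z))/(2(z−γ)) → −i/m_γ`, `Suzuki2025_prop41_eq41`). RH-FREE in fact; stated plainly.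
[cite: Suzuki2025WeilHilbertSpace, CJM Prop. 4.1 eq. (4.1) p. 10 (TeX l.1124–1127)] -/
theorem tendsto_lagariasTheta_suzukiZeroParam {ρ : ℂ} (hρ : ρ ∈ riemannZetaNontrivialZeros) :
    Tendsto lagariasTheta (𝓝[≠] suzukiZeroParam ρ) (𝓝 (-1)) := by
  have h := Suzuki2025_prop41_eq41 ρ hρ
  have h2 : Tendsto (fun z : ℂ ↦ 2 * (z - suzukiZeroParam ρ)) (𝓝[≠] suzukiZeroParam ρ) (𝓝 0) := by
    have : Tendsto (fun z : ℂ ↦ 2 * (z - suzukiZeroParam ρ)) (𝓝 (suzukiZeroParam ρ))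
        (𝓝 (2 * (suzukiZeroParam ρ - suzukiZeroParam ρ))) :=
      ((continuous_const.mul (continuous_id.sub continuous_const)).tendsto _)
    rw [sub_self, mul_zero] at this
    exact this.mono_left nhdsWithin_le_nhds
  have h3 := (h.mul h2).sub_const 1
  rw [mul_zero, zero_sub] at h3
  refine h3.congr' ?_
  filter_upwards [self_mem_nhdsWithin] with z hz
  have hz' : z - suzukiZeroParam ρ ≠ 0 := sub_ne_zero.2 hz
  field_simp
  ring

/-! ## B. The kernel at a real zero and the boundary values of `ψ̂` on `V(0)` (under RH) -/

open scoped Classical in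
/-- The **kernel vector at a (real) zero** `γ = γ_ρ`: `K_γ(x) := (i/2π)(1 + Θ_ξ(x))/(x − γ)`, an
honest `L²(ℝ)`-class for every `ρ ∈ Γ` (the cell's RH-free `memLp_two_one_add_theta_div`; it is
`F_γ/√(πm_γ)` with `F_γ` of CJM (3.5)). Junk `0` off `Γ`. RH-FREE object.
[cite: Suzuki2025WeilHilbertSpace, CJM eq. (3.5) p. 9 and Prop. 4.1 p. 10 (TeX l.1120–1139)] -/
def modelKernelVecReal (ρ : ℂ) : Lp ℂ 2 (volume : Measure ℝ) :=
  if hρ : ρ ∈ riemannZetaNontrivialZeros then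
    ((memLp_two_one_add_theta_div hρ).const_mul (I / Real.pi)).toLp _
  else 0

/-- `K_γ(x) = (2π)⁻¹·i(1 + Θ_ξ(x))/(x − γ)` almost everywhere.
[cite: Suzuki2025WeilHilbertSpace, CJM eq. (3.5) p. 9] -/
theorem coeFn_modelKernelVecReal {ρ : ℂ} (hρ : ρ ∈ riemannZetaNontrivialZeros) :
    (modelKernelVecReal ρ : ℝ → ℂ) =ᵐ[volume] fun x : ℝ ↦
      ((2 * Real.pi)⁻¹ : ℂ) * (I * (1 + lagariasTheta x) / (x - suzukiZeroParam ρ)) := by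
  unfold modelKernelVecReal
  rw [dif_pos hρ]
  filter_upwards [MemLp.coeFn_toLp ((memLp_two_one_add_theta_div hρ).const_mul (I / Real.pi))]
    with x hx
  rw [hx]
  have hπ : (Real.pi : ℂ) ≠ 0 := Complex.ofReal_ne_zero.2 Real.pi_ne_zero
  by_cases hx0 : (x : ℂ) - suzukiZeroParam ρ = 0
  · simp [hx0]
  field_simp

/-- The explicit kernel function `k(w, x) = (2π)⁻¹ i(1 − conj Θ(w)Θ(x))/(x − w̄)` (plumbing). [folklore] -/
private def kfun (w : ℂ) (x : ℝ) : ℂ :=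
  ((2 * Real.pi)⁻¹ : ℂ) * (I * (1 - conj (lagariasTheta w) * lagariasTheta x) / (x - conj w))

/-- The explicit limit kernel function `k₀(x) = (2π)⁻¹ i(1 + Θ(x))/(x − γ)` (plumbing). [folklore] -/
private def kfun₀ (γ : ℂ) (x : ℝ) : ℂ :=
  ((2 * Real.pi)⁻¹ : ℂ) * (I * (1 + lagariasTheta x) / (x - γ))

/-- `‖(2π)⁻¹·i·a/b‖ = (2π)⁻¹‖a‖/‖b‖` (plumbing). [folklore] -/
private theorem norm_kernel_shape (a b : ℂ) :
    ‖((2 * Real.pi)⁻¹ : ℂ) * (I * a / b)‖ = (2 * Real.pi)⁻¹ * (‖a‖ / ‖b‖) := by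
  rw [norm_mul, norm_div, norm_mul, Complex.norm_I, one_mul]
  congr 1
  rw [show ((2 * Real.pi)⁻¹ : ℂ) = (((2 * Real.pi)⁻¹ : ℝ) : ℂ) by push_cast; ring, Complex.norm_real,
    Real.norm_of_nonneg (by positivity)]

/-- **Boundary kernels converge: `K_{γ+iy} → K_γ` in `L²(ℝ)` as `y ↓ 0`** (under RH, `γ ∈ Γ`
real). Dominated convergence: near `γ`, `|1 − conj Θ(w)Θ(x)| = |conj q(w)|·|q(w̄) − q(x)| ≤ M²|x − w̄|`
by §A (reflection identity + mean value inequality), so `|K_w(x)| ≤ M²/2π`; away from `γ`,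
`|K_w(x)| ≤ 2/(π|x − γ|)` since `|Θ| ≤ 1` on `ℂ₊ ∪ ℝ`; pointwise `Θ(γ+iy) → −1`. RH-CONSEQUENCE.
[cite: Suzuki2025WeilHilbertSpace, CJM §2.4 p. 5 (TeX l.689–705: the model space 𝒦(Θ) ⊂ L²(ℝ) and its kernel) and Thm. 5.5 (1) proof p. 15 (TeX l.1753–1756: "ψ̂(γ) = c_γ/√(m_γπ) by applying (4.2) to ψ̂ = Σ c_γ F_γ")] -/
theorem tendsto_modelKernelVec (hRH : RiemannHypothesis) {ρ : ℂ}
    (hρ : ρ ∈ riemannZetaNontrivialZeros) :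
    Tendsto (fun y : ℝ ↦ modelKernelVec (suzukiZeroParam ρ + I * y)) (𝓝[>] 0)
      (𝓝 (modelKernelVecReal ρ)) := by
  set γ := suzukiZeroParam ρ with hγ
  set x₀ : ℝ := γ.re with hx₀
  have hγr : γ = (x₀ : ℂ) := suzukiZeroParam_eq_ofReal hRH hρ
  obtain ⟨q, r, hr, M, hM0, hqd, hqM, hqM', hΘq, hrefl⟩ := exists_ball_lagariasTheta_control x₀
  -- the points `w_y := γ + iy`
  have hw_im : ∀ y : ℝ, (γ + I * y).im = y := by
    intro y; rw [hγr]; simp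
  have hw_conj : ∀ y : ℝ, conj (γ + I * y) = (x₀ : ℂ) - I * y := by
    intro y; rw [hγr]
    simp only [map_add, map_mul, Complex.conj_ofReal, Complex.conj_I]; ring
  -- (1) the uniform bound near `γ`
  have hnear : ∀ y : ℝ, 0 < y → y < r → ∀ x : ℝ, (x : ℂ) ∈ Metric.ball (x₀ : ℂ) r → x ≠ x₀ →
      ‖kfun (γ + I * y) x‖ ≤ (2 * Real.pi)⁻¹ * M ^ 2 := by
    intro y hy hyr x hx hxne
    set w : ℂ := γ + I * y with hw
    have hwball : w ∈ Metric.ball (x₀ : ℂ) r := by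
      rw [Metric.mem_ball, dist_eq_norm, hw, hγr]
      simpa [abs_of_pos hy] using hyr
    have hwcball : conj w ∈ Metric.ball (x₀ : ℂ) r := by
      rw [Metric.mem_ball, dist_eq_norm, hw, hw_conj]
      simpa [abs_of_pos hy] using hyr
    have hwne : w ≠ x₀ := by
      intro h; have := congrArg Complex.im h; rw [hw, hw_im] at this; simp at this; linarith
    have hxne' : (x : ℂ) ≠ x₀ := fun h ↦ hxne (by exact_mod_cast h)
    have hΘw : lagariasTheta w = q w := hΘq w hwball hwne
    have hΘx : lagariasTheta x = q x := hΘq x hx hxne'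
    -- `1 − conj q(w) q(x) = conj q(w) (q(w̄) − q(x))`
    have hid : 1 - conj (q w) * q x = conj (q w) * (q (conj w) - q x) := by
      have := hrefl w hwball
      linear_combination -this
    have hmv : ‖q (conj w) - q x‖ ≤ M * ‖conj w - x‖ := by
      have := (convex_ball (x₀ : ℂ) r).norm_image_sub_le_of_norm_deriv_le hqd hqM' hx hwcball
      simpa using this
    have hden : ‖(x : ℂ) - conj w‖ = ‖conj w - x‖ := by rw [← norm_neg, neg_sub]
    have hden0 : 0 < ‖(x : ℂ) - conj w‖ := by
      rw [norm_pos_iff, sub_ne_zero]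
      intro h
      have := congrArg Complex.im h
      rw [hw, hw_conj] at this
      simp at this
      linarith
    rw [kfun, norm_kernel_shape, hΘw, hΘx, hid, norm_mul, Complex.norm_conj]
    refine mul_le_mul_of_nonneg_left ?_ (by positivity)
    rw [div_le_iff₀ hden0, hden]
    calc ‖q w‖ * ‖q (conj w) - q x‖ ≤ M * (M * ‖conj w - x‖) :=
          mul_le_mul (hqM w hwball) hmv (norm_nonneg _) hM0
      _ = M ^ 2 * ‖conj w - (x : ℂ)‖ := by ring
  -- (2) the bound away from `γ`
  have hfar : ∀ y : ℝ, 0 < y → y < r / 4 → ∀ x : ℝ, r / 2 ≤ |x - x₀| →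
      ‖kfun (γ + I * y) x‖ ≤ 2 / (Real.pi * |x - x₀|) := by
    intro y hy hyr x hx
    set w : ℂ := γ + I * y with hw
    have hΘw : ‖lagariasTheta w‖ ≤ 1 :=
      norm_lagariasTheta_le_one_of_im_pos hRH (by rw [hw, hw_im]; exact hy)
    have hΘx : ‖lagariasTheta x‖ ≤ 1 := norm_lagariasTheta_ofReal_le_one x
    have hnum : ‖1 - conj (lagariasTheta w) * lagariasTheta x‖ ≤ 2 := by
      calc ‖1 - conj (lagariasTheta w) * lagariasTheta x‖
          ≤ ‖(1 : ℂ)‖ + ‖conj (lagariasTheta w) * lagariasTheta x‖ := norm_sub_le _ _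
        _ ≤ 1 + 1 := by
            rw [norm_one, norm_mul, Complex.norm_conj]
            gcongr
            calc ‖lagariasTheta w‖ * ‖lagariasTheta ↑x‖ ≤ 1 * 1 :=
                  mul_le_mul hΘw hΘx (norm_nonneg _) zero_le_one
              _ = 1 := one_mul _
        _ = 2 := by norm_num
    have hx0pos : 0 < |x - x₀| := lt_of_lt_of_le (by positivity) hx
    have hden : |x - x₀| / 2 ≤ ‖(x : ℂ) - conj w‖ := by
      rw [hw, hw_conj]
      have e : (x : ℂ) - ((x₀ : ℂ) - I * y) = ((x - x₀ : ℝ) : ℂ) + I * y := by push_cast; ring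
      rw [e]
      have h1 : |x - x₀| ≤ ‖((x - x₀ : ℝ) : ℂ) + I * y‖ := by
        have := Complex.abs_re_le_norm (((x - x₀ : ℝ) : ℂ) + I * y)
        simpa using this
      linarith
    rw [kfun, norm_kernel_shape]
    have hden0 : 0 < ‖(x : ℂ) - conj w‖ := lt_of_lt_of_le (by positivity) hden
    calc (2 * Real.pi)⁻¹ * (‖1 - conj (lagariasTheta w) * lagariasTheta ↑x‖ / ‖(x : ℂ) - conj w‖)
        ≤ (2 * Real.pi)⁻¹ * (2 / (|x - x₀| / 2)) :=
          mul_le_mul_of_nonneg_left (div_le_div₀ (by norm_num) hnum (by positivity) hden)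
            (by positivity)
      _ = 2 / (Real.pi * |x - x₀|) := by
          field_simp
  -- (3) the single square-integrable majorant `B(x) = C₀/((x − x₀)² + (r/2)²)`
  set C₀ : ℝ := (2 * Real.pi)⁻¹ ^ 2 * M ^ 4 * (r ^ 2 / 2) + 8 / Real.pi ^ 2 with hC₀
  have hC₀0 : 0 ≤ C₀ := by positivity
  set B : ℝ → ℝ := fun x ↦ C₀ * ((x - x₀) ^ 2 + (r / 2) ^ 2)⁻¹ with hB
  have hBint : Integrable B := (integrable_inv_sub_sq_add_sq x₀ (by positivity)).const_mul C₀
  have hsq_bound : ∀ y : ℝ, 0 < y → y < r / 4 → ∀ x : ℝ, x ≠ x₀ →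
      ‖kfun (γ + I * y) x‖ ^ 2 ≤ B x := by
    intro y hy hyr x hxne
    have hD0 : 0 < (x - x₀) ^ 2 + (r / 2) ^ 2 := by positivity
    by_cases hx : |x - x₀| < r / 2
    · -- near
      have hxball : (x : ℂ) ∈ Metric.ball (x₀ : ℂ) r := by
        rw [Metric.mem_ball, dist_eq_norm, ← Complex.ofReal_sub, Complex.norm_real, Real.norm_eq_abs]
        linarith
      have h1 := hnear y hy (by linarith) x hxball hxne
      have h2 : ‖kfun (γ + I * y) x‖ ^ 2 ≤ ((2 * Real.pi)⁻¹ * M ^ 2) ^ 2 :=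
        pow_le_pow_left₀ (norm_nonneg _) h1 2
      have h3 : (x - x₀) ^ 2 < (r / 2) ^ 2 := by
        have := sq_lt_sq' (by linarith [abs_nonneg (x - x₀), neg_abs_le (x - x₀)]) (lt_of_le_of_lt (le_abs_self _) hx)
        exact this
      have h4 : 1 ≤ (r ^ 2 / 2) * ((x - x₀) ^ 2 + (r / 2) ^ 2)⁻¹ := by
        rw [le_mul_inv_iff₀ hD0]; nlinarith
      calc ‖kfun (γ + I * y) x‖ ^ 2 ≤ ((2 * Real.pi)⁻¹ * M ^ 2) ^ 2 * 1 := by rw [mul_one]; exact h2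
        _ ≤ ((2 * Real.pi)⁻¹ * M ^ 2) ^ 2 * ((r ^ 2 / 2) * ((x - x₀) ^ 2 + (r / 2) ^ 2)⁻¹) := by
            gcongr
        _ = ((2 * Real.pi)⁻¹ ^ 2 * M ^ 4 * (r ^ 2 / 2)) * ((x - x₀) ^ 2 + (r / 2) ^ 2)⁻¹ := by ring
        _ ≤ B x := by
            rw [hB]
            exact mul_le_mul_of_nonneg_right (by rw [hC₀]; linarith [show (0:ℝ) ≤ 8 / Real.pi ^ 2 by positivity])
              (inv_nonneg.2 hD0.le)
    · -- far
      push Not at hx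
      have h1 := hfar y hy hyr x hx
      have hx0pos : 0 < |x - x₀| := lt_of_lt_of_le (by positivity) hx
      have h2 : ‖kfun (γ + I * y) x‖ ^ 2 ≤ (2 / (Real.pi * |x - x₀|)) ^ 2 :=
        pow_le_pow_left₀ (norm_nonneg _) h1 2
      have h3 : (2 / (Real.pi * |x - x₀|)) ^ 2 = 4 / Real.pi ^ 2 * ((x - x₀) ^ 2)⁻¹ := by
        rw [div_pow, mul_pow, sq_abs]; field_simp; norm_num
      have h4 : ((x - x₀) ^ 2)⁻¹ ≤ 2 * ((x - x₀) ^ 2 + (r / 2) ^ 2)⁻¹ := by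
        have hx2 : (r / 2) ^ 2 ≤ (x - x₀) ^ 2 := by
          rw [← sq_abs (x - x₀)]; exact pow_le_pow_left₀ (by positivity) hx 2
        have hx2pos : 0 < (x - x₀) ^ 2 := by positivity
        have hle : ((x - x₀) ^ 2 + (r / 2) ^ 2) / 2 ≤ (x - x₀) ^ 2 := by linarith
        calc ((x - x₀) ^ 2)⁻¹ ≤ (((x - x₀) ^ 2 + (r / 2) ^ 2) / 2)⁻¹ :=
              inv_anti₀ (by positivity) hle
          _ = 2 * ((x - x₀) ^ 2 + (r / 2) ^ 2)⁻¹ := by rw [inv_div, div_eq_mul_inv]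
      calc ‖kfun (γ + I * y) x‖ ^ 2 ≤ 4 / Real.pi ^ 2 * ((x - x₀) ^ 2)⁻¹ := by rw [← h3]; exact h2
        _ ≤ 4 / Real.pi ^ 2 * (2 * ((x - x₀) ^ 2 + (r / 2) ^ 2)⁻¹) := by gcongr
        _ = 8 / Real.pi ^ 2 * ((x - x₀) ^ 2 + (r / 2) ^ 2)⁻¹ := by ring
        _ ≤ B x := by
            rw [hB]
            exact mul_le_mul_of_nonneg_right (by rw [hC₀]; linarith [show (0:ℝ) ≤ (2 * Real.pi)⁻¹ ^ 2 * M ^ 4 * (r ^ 2 / 2) by positivity])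
              (inv_nonneg.2 hD0.le)
  -- (4) pointwise convergence `k(γ+iy, x) → k₀(x)` for `x ≠ x₀`
  have hΘlim : Tendsto (fun y : ℝ ↦ lagariasTheta (γ + I * y)) (𝓝[>] 0) (𝓝 (-1)) := by
    have hT : Tendsto (fun y : ℝ ↦ γ + I * y) (𝓝[>] 0) (𝓝[≠] γ) := by
      refine tendsto_nhdsWithin_of_tendsto_nhds_of_eventually_within _ ?_ ?_
      · have : Tendsto (fun y : ℝ ↦ γ + I * y) (𝓝 0) (𝓝 (γ + I * (0 : ℝ))) :=
          (continuous_const.add (continuous_const.mul Complex.continuous_ofReal)).tendsto 0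
        rw [Complex.ofReal_zero, mul_zero, add_zero] at this
        exact this.mono_left nhdsWithin_le_nhds
      · filter_upwards [self_mem_nhdsWithin] with y hy
        intro h
        have := congrArg Complex.im h
        rw [hw_im, hγr, Complex.ofReal_im] at this
        exact (ne_of_gt hy) this
    exact (tendsto_lagariasTheta_suzukiZeroParam hρ).comp hT
  have hconjlim : Tendsto (fun y : ℝ ↦ conj (γ + I * y)) (𝓝[>] 0) (𝓝 (x₀ : ℂ)) := by
    have : Tendsto (fun y : ℝ ↦ (x₀ : ℂ) - I * y) (𝓝 0) (𝓝 ((x₀ : ℂ) - I * (0 : ℝ))) :=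
      (continuous_const.sub (continuous_const.mul Complex.continuous_ofReal)).tendsto 0
    rw [Complex.ofReal_zero, mul_zero, sub_zero] at this
    exact (this.mono_left nhdsWithin_le_nhds).congr fun y ↦ (hw_conj y).symm
  have hptw : ∀ x : ℝ, x ≠ x₀ → Tendsto (fun y : ℝ ↦ kfun (γ + I * y) x) (𝓝[>] 0) (𝓝 (kfun₀ γ x)) := by
    intro x hxne
    have hden : (x : ℂ) - x₀ ≠ 0 := sub_ne_zero.2 fun h ↦ hxne (by exact_mod_cast h)
    have h1 : Tendsto (fun y : ℝ ↦ 1 - conj (lagariasTheta (γ + I * y)) * lagariasTheta x)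
        (𝓝[>] 0) (𝓝 (1 - conj (-1 : ℂ) * lagariasTheta x)) :=
      tendsto_const_nhds.sub ((Complex.continuous_conj.tendsto _ |>.comp hΘlim).mul tendsto_const_nhds)
    have h2 : Tendsto (fun y : ℝ ↦ (x : ℂ) - conj (γ + I * y)) (𝓝[>] 0) (𝓝 ((x : ℂ) - x₀)) :=
      tendsto_const_nhds.sub hconjlim
    have h3 := ((tendsto_const_nhds (x := I)).mul h1).div h2 hden
    have h4 := (tendsto_const_nhds (x := ((2 * Real.pi)⁻¹ : ℂ))).mul h3
    refine h4.congr' (Eventually.of_forall fun y ↦ rfl) |>.trans ?_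
    simp only [kfun₀, map_neg, map_one, neg_mul, one_mul, sub_neg_eq_add, hγr]
    exact le_rfl
  -- (5) the integrals `∫ ‖k(γ+iy,·) − k₀‖²` tend to `0`
  have hk₀ : (modelKernelVecReal ρ : ℝ → ℂ) =ᵐ[volume] kfun₀ γ := coeFn_modelKernelVecReal hρ
  have hk₀sq : Integrable fun x : ℝ ↦ ‖kfun₀ γ x‖ ^ 2 := by
    have := (memLp_two_iff_integrable_sq_norm (Lp.aestronglyMeasurable _)).1
      (Lp.memLp (modelKernelVecReal ρ))
    exact this.congr (hk₀.mono fun x hx ↦ by simp only [hx])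
  have hae_ne : ∀ᵐ x : ℝ, x ≠ x₀ := by
    have : ({x₀}ᶜ : Set ℝ) ∈ ae (volume : Measure ℝ) := by rw [compl_mem_ae_iff, measure_singleton]
    exact this
  have hmeas_k : ∀ y : ℝ, 0 < y → AEStronglyMeasurable (fun x : ℝ ↦ kfun (γ + I * y) x) volume := by
    intro y hy
    exact (Lp.aestronglyMeasurable (modelKernelVec (γ + I * y))).congr
      (coeFn_modelKernelVec (w := γ + I * y) (by rw [hw_im]; exact hy))
  have hmeas_k₀ : AEStronglyMeasurable (kfun₀ γ) volume :=
    (Lp.aestronglyMeasurable (modelKernelVecReal ρ)).congr hk₀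
  set G : ℝ → ℝ → ℝ := fun y x ↦ ‖kfun (γ + I * y) x - kfun₀ γ x‖ ^ 2 with hG
  have hGlim : Tendsto (fun y : ℝ ↦ ∫ x, G y x) (𝓝[>] 0) (𝓝 0) := by
    have hr4 : Ioo (0 : ℝ) (r / 4) ∈ 𝓝[>] (0 : ℝ) := Ioo_mem_nhdsGT (by positivity)
    have h := tendsto_integral_filter_of_dominated_convergence (fun x : ℝ ↦ 2 * B x + 2 * ‖kfun₀ γ x‖ ^ 2)
      (l := 𝓝[>] (0 : ℝ)) (F := G) (f := fun _ ↦ 0) (μ := volume) ?_ ?_ ?_ ?_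
    · rwa [integral_zero] at h
    · filter_upwards [self_mem_nhdsWithin] with y hy
      exact (((hmeas_k y hy).sub hmeas_k₀).norm.pow 2)
    · filter_upwards [hr4] with y hy
      filter_upwards [hae_ne] with x hxne
      rw [hG, Real.norm_of_nonneg (by positivity)]
      calc ‖kfun (γ + I * y) x - kfun₀ γ x‖ ^ 2
          ≤ (‖kfun (γ + I * y) x‖ + ‖kfun₀ γ x‖) ^ 2 :=
            pow_le_pow_left₀ (norm_nonneg _) (norm_sub_le _ _) 2
        _ ≤ 2 * ‖kfun (γ + I * y) x‖ ^ 2 + 2 * ‖kfun₀ γ x‖ ^ 2 := by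
            nlinarith [sq_nonneg (‖kfun (γ + I * y) x‖ - ‖kfun₀ γ x‖)]
        _ ≤ 2 * B x + 2 * ‖kfun₀ γ x‖ ^ 2 := by
            gcongr; exact hsq_bound y hy.1 hy.2 x hxne
    · exact (hBint.const_mul 2).add (hk₀sq.const_mul 2)
    · filter_upwards [hae_ne] with x hxne
      have h := ((hptw x hxne).sub_const (kfun₀ γ x)).norm.pow 2
      rw [sub_self, norm_zero, zero_pow two_ne_zero] at h
      exact h
  -- (6) translate to the `L²` norm
  have hnorm : ∀ y : ℝ, 0 < y →
      ‖modelKernelVec (γ + I * y) - modelKernelVecReal ρ‖ ^ 2 = ∫ x, G y x := by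
    intro y hy
    rw [SuzukiOrthogonalSet.norm_sq_eq_integral_norm_sq]
    refine integral_congr_ae ?_
    filter_upwards [Lp.coeFn_sub (modelKernelVec (γ + I * y)) (modelKernelVecReal ρ),
      coeFn_modelKernelVec (w := γ + I * y) (by rw [hw_im]; exact hy), hk₀] with x h1 h2 h3
    rw [h1, Pi.sub_apply, h2, h3]
    rfl
  rw [tendsto_iff_norm_sub_tendsto_zero]
  have hsq : Tendsto (fun y : ℝ ↦ ‖modelKernelVec (γ + I * y) - modelKernelVecReal ρ‖ ^ 2)
      (𝓝[>] 0) (𝓝 0) :=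
    hGlim.congr' (by filter_upwards [self_mem_nhdsWithin] with y hy; exact (hnorm y hy).symm)
  have h := hsq.sqrt
  rw [Real.sqrt_zero] at h
  exact h.congr fun y ↦ by rw [Real.sqrt_sq (norm_nonneg _)]

/-- **Boundary values on `V(0)` under RH: `ψ̂(γ + iy) → ⟪K_γ, 𝖥ψ⟫` as `y ↓ 0`** for `ψ ∈ V(0)` and
`γ ∈ Γ` (`ψ̂(γ+iy) = ⟪K_{γ+iy}, 𝖥ψ⟫` by the RH-free reproducing formula, and `K_{γ+iy} → K_γ`).
This is the continuity of the evaluation functional at a real zero that the printed step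
"`ψ̂(γ) = c_γ/√(m_γπ)` by applying (4.2) to `ψ̂ = Σ c_γF_γ`" uses. RH-CONSEQUENCE.
[cite: Suzuki2025WeilHilbertSpace, CJM Thm. 5.5 (1) proof p. 15 (TeX l.1753–1756) and Lemma 5.3 p. 14 (TeX l.1545–1550: "V(0) ∋ ψ ↦ S_ψ := (ψ̂(γ))_{γ∈Γ}")] -/
theorem tendsto_upperHalfHat_of_mem_suzukiV (hRH : RiemannHypothesis) {ρ : ℂ}
    (hρ : ρ ∈ riemannZetaNontrivialZeros) {ψ : Lp ℂ 2 (volume : Measure ℝ)} (hψ : ψ ∈ suzukiV 0) :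
    Tendsto (fun y : ℝ ↦ upperHalfHat ψ (suzukiZeroParam ρ + I * y)) (𝓝[>] 0)
      (𝓝 (inner ℂ (modelKernelVecReal ρ) (suzukiFourierL2 ψ))) := by
  have hγr := suzukiZeroParam_eq_ofReal hRH hρ
  have h := Filter.Tendsto.inner (𝕜 := ℂ) (tendsto_modelKernelVec hRH hρ)
    (tendsto_const_nhds (x := suzukiFourierL2 ψ))
  refine h.congr' ?_
  filter_upwards [self_mem_nhdsWithin] with y hy
  refine inner_modelKernelVec hψ ?_
  rw [hγr]; simpa using hy

/-- **The value `ψ̂(γ)` exists for `ψ ∈ V(0)`, `γ ∈ Γ` (under RH)** and is `⟪K_γ, 𝖥ψ⟫`, in the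
junk-free sense `HasHatValue` of the `Defs` module (boundary clause). Clause (a) of the cell's
`Suzuki2025_lemma53` ("`S_ψ` is defined"). RH-CONSEQUENCE.
[cite: Suzuki2025WeilHilbertSpace, CJM Lemma 5.3 p. 14 (TeX l.1545–1550) and Thm. 5.5 (1) proof (TeX l.1753–1756)] -/
theorem hasHatValue_inner_modelKernelVecReal (hRH : RiemannHypothesis) {ρ : ℂ}
    (hρ : ρ ∈ riemannZetaNontrivialZeros) {ψ : Lp ℂ 2 (volume : Measure ℝ)} (hψ : ψ ∈ suzukiV 0) :
    HasHatValue ψ (suzukiZeroParam ρ) (inner ℂ (modelKernelVecReal ρ) (suzukiFourierL2 ψ)) :=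
  Or.inr (Or.inr ⟨suzukiZeroParam_im_eq_zero hRH hρ, tendsto_upperHalfHat_of_mem_suzukiV hRH hρ hψ⟩)

/-- **Uniqueness: every `HasHatValue`-value of `ψ ∈ V(0)` at `γ ∈ Γ` is `⟪K_γ, 𝖥ψ⟫`** (under RH
`γ` is real, so only the boundary clause applies, and limits in `𝓝[>] 0` are unique).
RH-CONSEQUENCE. [cite: Suzuki2025WeilHilbertSpace, CJM Lemma 5.3 p. 14 (TeX l.1545–1550)] -/
theorem HasHatValue.eq_inner_modelKernelVecReal (hRH : RiemannHypothesis) {ρ : ℂ}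
    (hρ : ρ ∈ riemannZetaNontrivialZeros) {ψ : Lp ℂ 2 (volume : Measure ℝ)} (hψ : ψ ∈ suzukiV 0)
    {c : ℂ} (hc : HasHatValue ψ (suzukiZeroParam ρ) c) :
    c = inner ℂ (modelKernelVecReal ρ) (suzukiFourierL2 ψ) := by
  have him := suzukiZeroParam_im_eq_zero hRH hρ
  rcases hc with ⟨h, -⟩ | ⟨h, -⟩ | ⟨-, h⟩
  · rw [him] at h; exact absurd h (lt_irrefl 0)
  · rw [him] at h; exact absurd h (lt_irrefl 0)
  · exact tendsto_nhds_unique h (tendsto_upperHalfHat_of_mem_suzukiV hRH hρ hψ)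

/-! ## C. Parseval in `V(0)`: the norm identity from the orthogonal basis (under RH) -/

/-- Suzuki's `𝖥` on `L²(ℝ)` as a CONTINUOUS LINEAR MAP (the cell's `suzukiFourierL2` is additive,
`ℂ`-homogeneous and continuous). RH-FREE object.
[cite: Suzuki2025WeilHilbertSpace, CJM §5 p. 13 (TeX l.1436–1444: "𝖥 … isometry up to a constant factor")] -/
def suzukiFourierL2CLM : Lp ℂ 2 (volume : Measure ℝ) →L[ℂ] Lp ℂ 2 (volume : Measure ℝ) where
  toFun := suzukiFourierL2
  map_add' := suzukiFourierL2_add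
  map_smul' := suzukiFourierL2_smul
  cont := continuous_suzukiFourierL2

/-- `suzukiFourierL2CLM ψ = 𝖥ψ`. [folklore] -/
@[simp] private theorem suzukiFourierL2CLM_apply (ψ : Lp ℂ 2 (volume : Measure ℝ)) :
    suzukiFourierL2CLM ψ = suzukiFourierL2 ψ := rfl

/-- **CJM Thm. 5.5 (1) from the orthogonal basis.** The cell's RH-CONSEQUENCE
`Suzuki2025_thm55_normIdentity` (`RH → ‖ψ‖² = ½⟨ψ,ψ⟩_W` on `V(0)`, the ONE fact the converse
`RH ⟹ IsolatedV0` rests on) follows from the RH-CONSEQUENCE `Suzuki2025_orthogonalBasis` (the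
complete orthogonal family `{ψ_γ}` with the values (4.2)), by the printed argument: Parseval in the
closed subspace `V(0)` for the orthonormal family `√(2π)ψ_γ`, and `ψ̂(γ) = ⟪K_γ, 𝖥ψ⟫ =
Σ_γ′ c_γ′ ψ̂_γ′(γ) = c_γ/√(m_γπ)` by continuity of the evaluation (§B), whence
`Σ_γ m_γ|ψ̂(γ)|² = π⁻¹Σ|c_γ|² = 2‖ψ‖²`; under RH `γ̄ = γ`, so this is the typed
`Σ m_γ ψ̂(γ) conj ψ̂(γ̄)`. RH-CONSEQUENCE ⟹ RH-CONSEQUENCE; kernel reduction of the residual's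
converse to the completeness clause alone. [cite: Suzuki2025WeilHilbertSpace, CJM Thm. 5.5 (1) p. 15, proof (TeX l.1713–1757), eq. (5.10)–(5.11), (1.2)] -/
theorem Suzuki2025_thm55_normIdentity_of_orthogonalBasis (hB : Suzuki2025_orthogonalBasis) :
    Suzuki2025_thm55_normIdentity := by
  intro hRH ψ hψ c hc
  classical
  obtain ⟨ψb, hV, hval, hvan, hnorm, horth, hcompl⟩ := hB hRH
  -- the ambient closed subspace `U = V(0)` and the orthonormal family `e ρ = √(2π) ψ_ρ`
  set U : Submodule ℂ (Lp ℂ 2 (volume : Measure ℝ)) := suzukiVSubmodule 0 with hU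
  haveI : CompleteSpace U := completeSpace_suzukiVSubmodule 0
  set s : ℝ := Real.sqrt (2 * Real.pi) with hs
  have hs0 : 0 < s := Real.sqrt_pos.2 Real.two_pi_pos
  have hs2 : s ^ 2 = 2 * Real.pi := Real.sq_sqrt Real.two_pi_pos.le
  set e : riemannZetaNontrivialZeros → U := fun ρ ↦
    ⟨(s : ℂ) • ψb ρ, (suzukiVSubmodule 0).smul_mem _ ((mem_suzukiVSubmodule).2 (hV ρ ρ.2))⟩ with he
  have he_coe : ∀ ρ : riemannZetaNontrivialZeros, ((e ρ : U) : Lp ℂ 2 (volume : Measure ℝ)) =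
      (s : ℂ) • ψb ρ := fun ρ ↦ rfl
  have horthonormal : Orthonormal ℂ e := by
    rw [orthonormal_iff_ite]
    intro ρ ρ'
    rw [Submodule.coe_inner, he_coe, he_coe, inner_smul_left, inner_smul_right, Complex.conj_ofReal]
    split_ifs with h
    · subst h
      have h1 : inner ℂ (ψb ρ) (ψb ρ) = ((‖ψb (ρ : ℂ)‖ ^ 2 : ℝ) : ℂ) := by
        rw [inner_self_eq_norm_sq_to_K]; norm_cast
      rw [h1]
      have h2 := hnorm ρ ρ.2
      have : (s : ℂ) * ((s : ℂ) * ((‖ψb (ρ : ℂ)‖ ^ 2 : ℝ) : ℂ)) = ((s ^ 2 * ‖ψb (ρ : ℂ)‖ ^ 2 : ℝ) : ℂ) := by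
        push_cast; ring
      rw [this, hs2, h2]; norm_cast
    · have hne : (ρ' : ℂ) ≠ ρ := fun h' ↦ h (Subtype.ext h'.symm)
      rw [horth ρ ρ.2 ρ' ρ'.2 hne, mul_zero, mul_zero]
  -- completeness (clause 6) makes the span dense in `U`
  have hdense : ⊤ ≤ (Submodule.span ℂ (Set.range e)).topologicalClosure := by
    rw [top_le_iff, Submodule.topologicalClosure_eq_top_iff, Submodule.eq_bot_iff]
    intro v hv
    rw [Submodule.mem_orthogonal'] at hv
    have h0 : ∀ ρ ∈ riemannZetaNontrivialZeros, inner ℂ (ψb ρ) (v : Lp ℂ 2 (volume : Measure ℝ)) = 0 := by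
      intro ρ hρ
      have h1 := hv (e ⟨ρ, hρ⟩) (Submodule.subset_span ⟨⟨ρ, hρ⟩, rfl⟩)
      rw [inner_eq_zero_symm, Submodule.coe_inner, he_coe, inner_smul_left, Complex.conj_ofReal,
        mul_eq_zero] at h1
      exact h1.resolve_left (by exact_mod_cast hs0.ne')
    have := hcompl v ((mem_suzukiVSubmodule).1 v.2) h0
    exact Subtype.ext this
  set b : HilbertBasis riemannZetaNontrivialZeros ℂ U := HilbertBasis.mk horthonormal hdense with hb
  have hb_apply : ∀ ρ, b ρ = e ρ := fun ρ ↦ by rw [hb, HilbertBasis.coe_mk]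
  set v : U := ⟨ψ, (mem_suzukiVSubmodule).2 hψ⟩ with hv
  -- the evaluation functional at `γ_ρ` as a continuous linear map on `U`
  have heval : ∀ ρ : riemannZetaNontrivialZeros,
      c (suzukiZeroParam ρ) = inner ℂ (b ρ) v * ((s / Real.sqrt ((riemannZetaZeroOrder (ρ : ℂ) : ℝ) * Real.pi) : ℝ) : ℂ) := by
    intro ρ
    set L : U →L[ℂ] ℂ :=
      (innerSL ℂ (modelKernelVecReal (ρ : ℂ))).comp (suzukiFourierL2CLM.comp U.subtypeL) with hL
    have hLapply : ∀ u : U, L u = inner ℂ (modelKernelVecReal (ρ : ℂ)) (suzukiFourierL2 (u : Lp ℂ 2 (volume : Measure ℝ))) :=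
      fun u ↦ rfl
    -- `c(γ_ρ) = L v`
    have hcv : c (suzukiZeroParam ρ) = L v := by
      rw [hLapply]
      exact (hc ρ ρ.2).eq_inner_modelKernelVecReal hRH ρ.2 hψ
    -- `L (b ρ') = s · ψ̂b_ρ'(γ_ρ)`
    have hLb : ∀ ρ' : riemannZetaNontrivialZeros, L (b ρ') =
        (s : ℂ) * (if ρ' = ρ then (((Real.sqrt ((riemannZetaZeroOrder (ρ : ℂ) : ℝ) * Real.pi))⁻¹ : ℝ) : ℂ) else 0) := by
      intro ρ'
      rw [hLapply, hb_apply, he_coe, suzukiFourierL2_smul, inner_smul_right]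
      congr 1
      split_ifs with h
      · subst h
        exact ((hval ρ' ρ'.2).eq_inner_modelKernelVecReal hRH ρ'.2 (hV ρ' ρ'.2)).symm
      · have hne : (ρ : ℂ) ≠ ρ' := fun h' ↦ h (Subtype.ext h'.symm)
        exact ((hvan ρ' ρ'.2 ρ ρ.2 hne).eq_inner_modelKernelVecReal hRH ρ.2 (hV ρ' ρ'.2)).symm
    -- expand `v` in the basis and apply `L`
    have hsum := (b.hasSum_repr v).mapL L
    have hsum' : HasSum (fun ρ' : riemannZetaNontrivialZeros ↦
        if ρ' = ρ then inner ℂ (b ρ) v * ((s : ℂ) * (((Real.sqrt ((riemannZetaZeroOrder (ρ : ℂ) : ℝ) * Real.pi))⁻¹ : ℝ) : ℂ)) else 0) (L v) := by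
      refine hsum.congr_fun fun ρ' ↦ ?_
      rw [ContinuousLinearMap.map_smul, b.repr_apply_apply, hLb, smul_eq_mul]
      split_ifs with h
      · subst h; rfl
      · rw [mul_zero, mul_zero]
    have hval' := (hasSum_ite_eq ρ (inner ℂ (b ρ) v * ((s : ℂ) * (((Real.sqrt ((riemannZetaZeroOrder (ρ : ℂ) : ℝ) * Real.pi))⁻¹ : ℝ) : ℂ)))).unique hsum'
    rw [hcv, ← hval']
    push_cast
    ring
  -- Parseval: `Σ ⟪v, b ρ⟫⟪b ρ, v⟫ = ⟪v, v⟫ = ‖ψ‖²`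
  have hpar := (b.hasSum_inner_mul_inner v v).mul_left (2 : ℂ)
  have hvv : (2 : ℂ) * inner ℂ v v = ((2 * ‖ψ‖ ^ 2 : ℝ) : ℂ) := by
    have h1 : inner ℂ v v = ((‖v‖ : ℂ)) ^ 2 := inner_self_eq_norm_sq_to_K v
    have h2 : ‖v‖ = ‖ψ‖ := rfl
    rw [h1, h2]; push_cast; ring
  rw [hvv] at hpar
  refine hpar.congr_fun fun ρ ↦ ?_
  -- termwise: `m c(γ) conj c(γ̄) = 2 ⟪v, bρ⟫⟪bρ, v⟫`
  have hγreal : conj (suzukiZeroParam (ρ : ℂ)) = suzukiZeroParam ρ := by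
    rw [suzukiZeroParam_eq_ofReal hRH ρ.2, Complex.conj_ofReal]
  rw [hγreal, heval ρ]
  have hm0 : (0 : ℝ) < riemannZetaZeroOrder (ρ : ℂ) := by
    exact_mod_cast riemannZetaNontrivialZeros.one_le_order ρ.2
  set t : ℝ := s / Real.sqrt ((riemannZetaZeroOrder (ρ : ℂ) : ℝ) * Real.pi) with ht
  have ht2 : (riemannZetaZeroOrder (ρ : ℂ) : ℝ) * t ^ 2 = 2 := by
    rw [ht, div_pow, hs2, Real.sq_sqrt (by positivity)]
    field_simp
  have hcast : (riemannZetaZeroOrder (ρ : ℂ) : ℂ) = ((riemannZetaZeroOrder (ρ : ℂ) : ℝ) : ℂ) := by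
    norm_cast
  have ht2' : ((riemannZetaZeroOrder (ρ : ℂ) : ℝ) : ℂ) * (t : ℂ) ^ 2 = 2 := by exact_mod_cast ht2
  rw [map_mul, Complex.conj_ofReal, ← inner_conj_symm v (b ρ), hcast]
  linear_combination (conj (inner ℂ (b ρ) v) * inner ℂ (b ρ) v) * ht2'

end Literature.NumberTheory.LFunctions

end
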